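import Summits.Ventures.PercRepro.C026PFunCurveL2
import Summits.Ventures.PercRepro.C026PFunCycleDefs
import Summits.Ventures.PercRepro.C026ClassEdge

/-!
# THEOREM L2 is unconditional when the probe is adjacent to a live vertex (p6, gen 17)

mine-3's class theorem on a `c`–`a` edge (p5's `slackCF_nonneg_of_edge`, C026ClassEdge): if some edge
joins the probe `c` to the live vertex `a`, then `0 ≤ slackCF a b c`, hence `(E00)`, hence THEOREM L2
at every band state of the probe and of the two live vertices (`C026PFunCurveL2`).  In particular
CONJECTURE (P) holds on the triangle through the probe — THEOREM C for `k = 2` (`pFun_cycle_two_nonneg`),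
for every band probe and band components.
-/

namespace PercRepro

namespace MultiGraph

open Finset

variable {V E : Type*} [Fintype V] [DecidableEq V] [Fintype E] [DecidableEq E]
  {G : MultiGraph V E}

/-- **THEOREM L2 with an edge `ca`, unconditionally**: `(P) ≥ 0` at every band state of the probe
and of the two live vertices `a, b` whenever some edge joins `c` and `a`. -/
theorem pFun_threeCells_nonneg_of_edge {a b c : V} (e : E)
    (he : (G.fst e = c ∧ G.snd e = a) ∨ (G.fst e = a ∧ G.snd e = c)) {z κ x₁ K₁ x₂ K₂ : ℝ}
    (hz : 0 ≤ z ∧ z ≤ 1) (hκ : kMin z ≤ κ) (hx₁ : 0 ≤ x₁ ∧ x₁ ≤ 1) (hx₂ : 0 ≤ x₂ ∧ x₂ ≤ 1)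
    (hK₁ : kMin x₁ ≤ K₁) (hK₂ : kMin x₂ ≤ K₂) :
    0 ≤ G.pFun c (threeCells c a b z x₁ x₂) (threeCells c a b κ K₁ K₂) univ :=
  pFun_threeCells_nonneg_of_slackCF c a b (G.slackCF_nonneg_of_edge e he) hz hκ hx₁ hx₂ hK₁ hK₂

omit [Fintype V] [DecidableEq V] [Fintype E] [DecidableEq E] in
/-- Any cells on the three vertices of the triangle are three-live cells. -/
theorem threeCells_option_fin_two (x : Option (Fin 2) → ℝ) :
    threeCells none (some 0) (some 1) (x none) (x (some 0)) (x (some 1)) = x := by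
  funext v
  rcases v with _ | ⟨i, hi⟩
  · simp [threeCells]
  · interval_cases i <;> simp [threeCells]

/-- **THEOREM C for `k = 2`** (the triangle through the probe): CONJECTURE (P) holds on the cycle
`cycle 2` for every band probe and band components — THEOREM L2 with the edge `e₀ = c v₁`. -/
theorem pFun_cycle_two_nonneg {x K : Option (Fin 2) → ℝ} (hx : ∀ v, 0 ≤ x v ∧ x v ≤ 1)
    (hK : ∀ v, kMin (x v) ≤ K v) : 0 ≤ (cycle 2).pFun none x K univ := by
  rw [← threeCells_option_fin_two x, ← threeCells_option_fin_two K]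
  exact pFun_threeCells_nonneg_of_edge (0 : Fin 3) (Or.inl ⟨by rfl, by rfl⟩) (hx none) (hK none)
    (hx (some 0)) (hx (some 1)) (hK (some 0)) (hK (some 1))

end MultiGraph

end PercRepro
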